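import Summits.QuantumFields.BalabanUV.T4Continuum.Support.ShellMeasureRootCompositionSU2
import Summits.QuantumFields.BalabanUV.T4Continuum.Support.ShellMeasureWilsonGaugeInvariant
import Summits.QuantumFields.BalabanUV.T4Continuum.Support.ShellMeasureLevelZeroWords

/-!
# `T4Continuum.ShellMeasureRootCompositionLevelZero` — NE7c ROOT COMPOSITION, END-II SPECIALISED TO LEVEL 0: the
# binders of END-II (`ShellMeasureRootCompositionSU2.slotAC_realized_su2_of_levelData`) are JOINTLY INHABITED at
# `j = 0` by the cell's own objects, and the gauge-invariant level-0 headline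
# (`ShellMeasureWilsonGaugeInvariant.slotAntiConcentration_wilson_su2_gaugeInvariant`, p207446) is RE-DERIVED from it
# (cell `pub-balaban`, sub-cell `t4`, spine estimate NE7c (node U5b); crew row S11 of the claim table
# `t4/b2b-balaban-t4-ne7c-p1/LEAVES-NE7c-P1.md`, seat `t4-ne7c-formalise-leaf-09`, file 2 of 2; ADDITIVE — imports
# `ShellMeasureRootCompositionSU2` (p207698), `ShellMeasureWilsonGaugeInvariant` (p207446) and file 1
# `ShellMeasureLevelZeroWords` only; 0 `def`, 0 sorry)

HONEST FRAMING.  Finite four-torus programme, rung (B)+1 only — NOT infinite volume, NOT a mass gap, NOT the Clay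
problem, NOT summit progress; (B), `BetaPertHyp`, (B^μ) not consumed.  (M1) for BAŁABAN'S INDUCTIVELY DEFINED
EFFECTIVE MEASURES is NOT PRINTED (GAPS G-ne7cp1-1), asserted by nobody, NOT moved here.  (M1)₀ realized ≠ NE7c
(`t4/T4-NE7c-TRIGGER.json` c3): this file is an INSTANTIABILITY CHECK of END-II's binder shapes at the one level where
the cell owns every object, nothing more.  HONEST DEPENDENCY (cell): continuum YM on T⁴ ⇐ BetaPertH ∧ nine spine
estimates (0/9 proved); BetaPertH ⇐ (D1) ∧ (D4) ∧ CAP+tail; G-an2-4 gates asym, D1 and NE2/3/4.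

FINDING (F-ne7cleaf09-1, journal).  END-II as landed asks its DICTIONARY binder
`hRdict : ∀ V x, R V (expFibreChart Λ (c V) e x) = Jco V x * weight …` for EVERY chart point `x ∈ ℝⁿ`.  The
exponential chart is `2π`-periodic in each bond direction, so a cube point `x` with `R V (chart x) ≠ 0` has a copy
`x' ∉ cube` with the same chart image, where `hRdict` forces `Jco V x' ≠ 0`, hence (`hJW`, `hJ`) the ray to `x'` lies
in the window `W V`, on which (AN-bound) `hAN` is asked with ONE pair `(Rad, H)` while `hudict` pins the classifier
along that ray to the Wilson variable of a bond passing through `−1`: no level-0 data with the (AN-bound)₀ constant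
`H = e^{8S·Rad} − 1` can inhabit that.  END-II's PROOF uses `hRdict` on the chart cube `[-S,S]ⁿ` only (off the cube
both sides of its density identity vanish by the cube indicator) and `hudict` only to rename the tested variable,
whose law lives on the cube.  §1 below is END-II with exactly these two binders asked on the cube — statement
otherwise byte-identical, proof = the author's plus one indicator case split and a support-congruence for the tested
variable; it is the form that level 0 inhabits (§2) and that the row owner adopted as the consumers' target (journal,
ANSWER to F-ne7cleaf09-1).  Nothing else of END-II is questioned.

## What is proved ([folklore] bookkeeping; no def)

* §1 `slotAntiConcentration_congr_offNull` ((M1) sees the tested variable only on the support of the density) and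
  `slotAC_realized_su2_of_levelData_cube`: END-II with the dictionary `hRdict`/`hudict` asked for `x ∈ cube n S` only.
* §2 `slotAntiConcentration_wilson_su2_gaugeInvariant_of_levelData`: the CONCLUSION of p207446 verbatim — same
  realized measure `(fieldMeasure P j SU2).withDensity (giF lo hi σ β Pw)`, same classifier `wilsonU`, same constant
  `2(n + β Σ_{p∈P_w} 8S(8 + 32S))/(1−δ)` — obtained FROM §1 by inhabiting its level data on the cell's objects: tree
  = the axial comb (`noClosedLoop_combBonds`), `U₀ = 1`, centre `1`, `R V y = giF (V[comb := 1][Λ := y])`, trace datum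
  `Re Tr` on `M₂(ℂ)`, `hol V p` / `G V p` = the sectioned plaquette words of `V[comb := 1]`, `𝓔 ≡ 0` (`B_𝓔 = 0`),
  `W V = [-S,S]ⁿ`, `Jco V = 1_{[-S,S]ⁿ} · 1[box co-test of the section]` (centre-monotone on the cube by the level-0
  core map at threshold `σ`, `ShellMeasureWilsonWords.coreMap_word`), (AN-bound)₀ pair `(Rad, e^{8S·Rad} − 1)` for any
  `Rad > 1`, sizes `s̄ = L̄ = 8S`, `d̄ = 8`.  The smallness is END-II's (SM) in its own currency,
  `36(e^{8S·Rad} − 1)/(Rad − 1)² ≤ δθ`, plus (SM)_σ `4(8S)²e^{16S} ≤ δσ` for the co-test; the window factorisation is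
  the (LR)₀ reach lemma of `ShellMeasureAxialReach` exactly as in p207446; the level data in kernel form (graded
  words moving linearly, the `plaquetteFn` witness, continuity) are file 1 `ShellMeasureLevelZeroWords`.

WHAT THIS DOES NOT DO.  No live level `j ≥ 1` (there `hol`, `G`, `𝓔` are functionals of the localized MINIMISER and
the binders SM-L1…L6 are located, NOT PRINTED as numbers); (MR)₀ untouched; NE7c NOT proved; 0/9 spine.
-/

noncomputable section

open NormedSpace Set Function MeasureTheory Metric

namespace Summit.QuantumFields.BalabanUV.T4Continuum.ShellMeasureRootCompositionLevelZero

open scoped ENNReal Matrix.Norms.L2Operator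
open Literature.MathematicalPhysics.QuantumFieldTheory.Balaban1983to89
open GaugeField (GaugeInvariant)
open T4ShellMeasure (SlotAntiConcentration)
open T4CubePoincare (cube measurableSet_cube')
open T4CubeChartGnomonic (SU2)
open T4CubeChartExp (expJac expWindowDensity expFibreChart expWindowDensity_congr)
open T4ShellMeasureDet (blockLaw)
open T4TreeGaugeFixing (NoClosedLoop fixTo measurable_fixTo noClosedLoop_combBonds)
open T4AxialGaugeFixing (combBonds)
open T4AxialGaugeSmallField (boxPlaqs boxBonds)
open ShellMeasureScalingSU2 (chartLaw_univ_eq mem_cube_of_chartWeight_ne_zero chartWeight_le_smul smul_mem_cube)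
open ShellMeasureWilsonWords (scale normSum wordExp coreMap_word interpConst_mono normSum_nonneg)
open ShellMeasureWilsonTrace (Letter wordEval sGen dFro TraceData)
open ShellMeasureWilsonMoving (MLetter mwordEval mdFro sSum lSum)
open ShellMeasureWilsonBlock (matrixTrace matrixTrace_N_pos wilson_dictionary_specialUnitaryGroup)
open ShellMeasureWilsonRealizedSU2 (M₂ plaqWord coe_plaqHol_eq_wordEval wordEval_plaqWord_smul plaqWord_data wilsonU
  measurable_wilsonU wilsonSum_chart_smul)
open ShellMeasureLevelAssembly (classifier weight action slotAntiConcentration_of_levelData)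
open ShellMeasureRootCompositionSU2 (slotAC_realized_su2_of_chartAC_gauge)
open ShellMeasureHeadlines (fixTo_updateFinset_of_disjoint)
open ShellMeasureAxialReach (fixTo_comb_eq_one expWindowDensity_eq_one_of_comb)
open ShellMeasureWilsonGaugeInvariant (boxTest giF exists_gens_of_frozen_eq_one frozen_eq_one_of_mem_plaqWord
  measurable_giF giF_le_one gaugeInvariant_giF gaugeInvariant_wilsonU withDensity_univ_ne_top_of_le_one)
open ShellMeasureLevelZeroWords (exists_graded_of_word classifierWitness_linear continuous_wordEval_plaqWord)

/-! ## §1 END-II with the dictionary asked on the chart cube -/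

section EndTwoCube

variable {P : Params} {j : ℕ} [DecidableEq (PBond P j)]
variable {A : Type*} [NormedRing A] [NormedAlgebra ℂ A] [CompleteSpace A] [NormOneClass A]

omit [DecidableEq (PBond P j)] in
/-- **(M1) SEES THE TESTED VARIABLE ONLY ON THE SUPPORT.**  For a density `f` vanishing off a measurable set `K`,
`SlotAntiConcentration (ν.withDensity f) u θ ρ D` depends on `u` only through `u|_K`: two tested variables agreeing
on `K` give the same shell and total masses (`Kᶜ` is `ν.withDensity f`-null). [folklore] -/
theorem slotAntiConcentration_congr_offNull {Ω : Type*} [MeasurableSpace Ω] (ν : Measure Ω) {f : Ω → ℝ≥0∞}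
    {K : Set Ω} (hK : MeasurableSet K) (hf : ∀ x ∉ K, f x = 0) {u u' : Ω → ℝ} (huu' : ∀ x ∈ K, u x = u' x)
    {θ ρ D : ℝ} (h : SlotAntiConcentration (ν.withDensity f) u' θ ρ D) :
    SlotAntiConcentration (ν.withDensity f) u θ ρ D := by
  have hnull : ν.withDensity f Kᶜ = 0 := by
    rw [withDensity_apply _ hK.compl, setLIntegral_congr_fun hK.compl (g := fun _ => 0) fun x hx => hf x hx,
      lintegral_zero]
  have hK_ae : ∀ᵐ x ∂ν.withDensity f, x ∈ K := mem_ae_iff.2 hnull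
  have hae : {x | θ * (1 - ρ) ≤ u x ∧ u x < θ} =ᵐ[ν.withDensity f] {x | θ * (1 - ρ) ≤ u' x ∧ u' x < θ} := by
    filter_upwards [hK_ae] with x hx
    simp only [eq_iff_iff]
    show x ∈ {x | θ * (1 - ρ) ≤ u x ∧ u x < θ} ↔ x ∈ {x | θ * (1 - ρ) ≤ u' x ∧ u' x < θ}
    rw [mem_setOf_eq, mem_setOf_eq, huu' x hx]
  unfold SlotAntiConcentration at h ⊢
  rw [measure_congr hae]
  exact h

/-- **END-II, DICTIONARY ON THE CHART CUBE — REALIZED (M1) ⇐ SM-L1…L6 + DICTIONARY, PER SLOT (`G = SU(2)`).**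
Word for word `ShellMeasureRootCompositionSU2.slotAC_realized_su2_of_levelData` (data: loop-free tree `T`, prescribed
values `U₀`, chart bonds `Λ` with enumeration `e`, window half-side `S`, chart centres `c V`, block weights `R V`,
gauge-invariant realized density `F` with window factorisation `hFw` and per-section finiteness `hfin`,
gauge-invariant tested variable `u`; LEVEL DATA per exterior `V` in a complete normed `ℂ`-algebra `A` with trace
datum `Ttr`: `hol`, `G`, `𝓔`, `W`, `Jco`, sizes, numbers; BINDERS `hJW`/`hJ` (SM-L5/L6), `hAN` (SM-L1), `hGW` (SM-L3),
`hE` (SM-L4), `hSM` (SM-L2)) EXCEPT that the two DICTIONARY identities — `hRdict` «on the chart the block weight IS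
`Jco V · weight Ttr β P_w (G V) (𝓔 V)`» and `hudict` «the tested variable of the tree-gauged section IS
`classifier hPu (hol V)`» — are asked for chart points `x ∈ [-S,S]ⁿ` ONLY (the support of the chart law; see the module
docstring for why the unrestricted form is not inhabitable; `slotAntiConcentration_congr_offNull` for the tested
variable).  CONCLUSION (unchanged):
`SlotAntiConcentration ((fieldMeasure P j SU2).withDensity F) u θ ρ (2(n + β Σ_p L̄_p(d̄_p + 4s̄_p) + B_𝓔)/(1−δ))`.
CONDITIONAL on every binder; nothing PRINTED is asserted. [folklore] -/
theorem slotAC_realized_su2_of_levelData_cube {T : Finset (PBond P j)} (hT : NoClosedLoop T)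
    (U₀ : GaugeField P j SU2) (Λ : Finset (PBond P j)) {n : ℕ} (e : ↥Λ × Fin 3 ≃ Fin n)
    {S : ℝ} (hS : 0 < S) (hSπ : 3 * S ^ 2 < Real.pi ^ 2) (c : GaugeField P j SU2 → GaugeField P j SU2)
    {R : GaugeField P j SU2 → (↥Λ → SU2) → ℝ≥0∞} (hR : ∀ V, Measurable (R V))
    {F : GaugeField P j SU2 → ℝ≥0∞} (hF : Measurable F) (hFi : GaugeInvariant F)
    (hFw : ∀ V y, F (fixTo T U₀ (updateFinset V Λ y)) =
      ENNReal.ofReal (expWindowDensity Λ (c V) S (updateFinset (c V) Λ y)) * R V y)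
    (hfin : ∀ V, ((blockLaw Λ).withDensity fun y => F (fixTo T U₀ (updateFinset V Λ y))) univ ≠ ∞)
    {u : GaugeField P j SU2 → ℝ} (hu : Measurable u) (hui : GaugeInvariant u)
    -- level data per exterior section
    (Ttr : TraceData A) (hN : 0 < Ttr.N) {ι κ : Type*} {Pu : Finset ι} (hPu : Pu.Nonempty)
    (hol : GaugeField P j SU2 → ι → (Fin n → ℝ) → A) (hcont : ∀ V, ∀ p ∈ Pu, Continuous (hol V p))
    (Pw : Finset κ) (G : GaugeField P j SU2 → κ → (Fin n → ℝ) → A) (𝓔 : GaugeField P j SU2 → (Fin n → ℝ) → ℝ)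
    (W : GaugeField P j SU2 → Set (Fin n → ℝ)) (Jco : GaugeField P j SU2 → (Fin n → ℝ) → ℝ≥0∞)
    {θ δ ρ β Rad H B𝓔 : ℝ} {sw lw dw : κ → ℝ}
    -- DICTIONARY (block weight: on the chart cube only)
    (hRdict : ∀ V, ∀ x ∈ cube n S,
      R V (expFibreChart Λ (c V) e x) = Jco V x * weight Ttr β Pw (G V) (𝓔 V) x)
    (hudict : ∀ V, ∀ x ∈ cube n S,
      u (fixTo T U₀ (updateFinset V Λ (expFibreChart Λ (c V) e x))) = classifier hPu (hol V) x)
    -- SM-L5/L6: kept co-tests supported in the window, centre-monotone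
    (hJW : ∀ V x, Jco V x ≠ 0 → x ∈ W V)
    (hJ : ∀ V x, ∀ a : ℝ, 0 ≤ a → Jco V x ≤ Jco V (Real.exp (-a) • x))
    -- SM-L1 (AN-bound)
    (hRad : 1 < Rad)
    (hAN : ∀ V, ∀ x ∈ W V, ∀ p ∈ Pu, ∃ f : ℂ → A, DifferentiableOn ℂ f (ball 0 Rad) ∧
      (∀ w ∈ ball (0 : ℂ) Rad, ‖f w‖ ≤ H) ∧ f 0 = 0 ∧ ∀ c' : ℝ, 0 ≤ c' → c' ≤ 1 → f (c' : ℂ) = hol V p (c' • x) - 1)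
    -- SM-L3 graded sectioned words
    (hGW : ∀ V, ∀ x ∈ W V, ∀ p ∈ Pw, ∃ gw : List (MLetter A × ℝ × ℝ), (∀ y ∈ gw, y.1.Good Ttr.τ y.2.1 y.2.2) ∧
      sSum gw ≤ sw p ∧ lSum gw ≤ lw p ∧ mdFro (gw.map Prod.fst) ≤ dw p ∧
      ∀ c' : ℝ, 0 ≤ c' → c' ≤ 1 → mwordEval c' (gw.map Prod.fst) = G V p (c' • x))
    (hsw1 : ∀ p ∈ Pw, sw p ≤ 1) (hsw0 : ∀ p ∈ Pw, 0 ≤ sw p) (hlw0 : ∀ p ∈ Pw, 0 ≤ lw p)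
    (hdw0 : ∀ p ∈ Pw, 0 ≤ dw p)
    -- SM-L4 non-Wilson ray bound
    (hE : ∀ V, ∀ x ∈ W V, ∀ c' : ℝ, 1 / 2 ≤ c' → c' ≤ 1 → 𝓔 V (c' • x) ≤ 𝓔 V x + (1 - c') * B𝓔) (hB𝓔 : 0 ≤ B𝓔)
    -- numbers + SM-L2 (SM)
    (hθ : 0 < θ) (hδ0 : 0 ≤ δ) (hδ1 : δ < 1) (hρ0 : 0 ≤ ρ) (hρ : ρ ≤ (1 - δ) / 2) (hβ : 0 ≤ β)
    (hSM : 36 * H * 1 ^ 2 / (Rad - 1) ^ 2 ≤ δ * θ) :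
    SlotAntiConcentration ((fieldMeasure P j SU2).withDensity F) u θ ρ
      (2 * ((n : ℝ) + (β * ∑ p ∈ Pw, lw p * (dw p + 4 * sw p) + B𝓔)) / (1 - δ)) := by
  refine slotAC_realized_su2_of_chartAC_gauge hT U₀ Λ e hS hSπ c hR hF hFi hFw hu hui fun V => ?_
  -- the chart law of the section
  have hsecF : (fun y => F (fixTo T U₀ (updateFinset V Λ y))) =
      fun y => ENNReal.ofReal (expWindowDensity Λ (c V) S (updateFinset (c V) Λ y)) * R V y := funext (hFw V)
  -- the density rewritten through the dictionary ON THE CUBE; off the cube both sides vanish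
  have hdens : (fun x : Fin n → ℝ => (cube n S).indicator (fun x => ENNReal.ofReal (Real.exp (-expJac Λ e x))) x *
        R V (expFibreChart Λ (c V) e x)) =
      fun x => ((cube n S).indicator (fun x => ENNReal.ofReal (Real.exp (-expJac Λ e x))) x * Jco V x) *
        weight Ttr β Pw (G V) (𝓔 V) x := by
    funext x
    by_cases hx : x ∈ cube n S
    · rw [hRdict V x hx, mul_assoc]
    · simp only [indicator_of_notMem hx, zero_mul]
  rw [hdens]
  -- finiteness of the sub-threshold mass of the chart law (from the section's finite mass)
  have hfin' : ((volume : Measure (Fin n → ℝ)).withDensity fun x =>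
      ((cube n S).indicator (fun x => ENNReal.ofReal (Real.exp (-expJac Λ e x))) x * Jco V x) *
        weight Ttr β Pw (G V) (𝓔 V) x) {x | classifier hPu (hol V) x < θ} ≠ ∞ := by
    refine ne_top_of_le_ne_top ?_ (measure_mono (subset_univ _))
    rw [← hdens, chartLaw_univ_eq Λ (c V) e hS hSπ (hR V), ← hsecF]
    exact hfin V
  -- the one-depth assembly on the chart, window ∩ cube as the window, chart weight × co-tests as the factor
  have h := slotAntiConcentration_of_levelData (volume : Measure (Fin n → ℝ)) Ttr hN hPu (hol V) (hcont V) Pw (G V)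
    (𝓔 V) (W := W V ∩ cube n S)
    (J := fun x => (cube n S).indicator (fun x => ENNReal.ofReal (Real.exp (-expJac Λ e x))) x * Jco V x)
    (fun x hx => ⟨hJW V x (right_ne_zero_of_mul hx), mem_cube_of_chartWeight_ne_zero (left_ne_zero_of_mul hx)⟩)
    (fun x a ha => mul_le_mul' (chartWeight_le_smul e hSπ ha x) (hJ V x a ha)) hRad
    (fun x hx p hp => hAN V x hx.1 p hp) (fun x hx p hp => hGW V x hx.1 p hp) hsw1 hsw0 hlw0 hdw0
    (fun x hx c' h1 h2 => hE V x hx.1 c' h1 h2) hB𝓔 hθ hδ0 hδ1 hρ0 hρ hβ hSM hfin'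
  simp only [Module.finrank_fintype_fun_eq_card, Fintype.card_fin] at h
  -- the tested variable is read through the dictionary ON THE CUBE; off the cube the chart law vanishes
  exact slotAntiConcentration_congr_offNull volume (measurableSet_cube' n S)
    (fun x hx => by simp only [indicator_of_notMem hx, zero_mul]) (hudict V) h

end EndTwoCube


/-! ## §2 The gauge-invariant level-0 headline DERIVED FROM END-II -/

section Main

variable {P : Params} {j : ℕ} [DecidableEq (PBond P j)]

/-- **(M1)₀ REALIZED (`G = SU(2)`, GAUGE-INVARIANT DENSITY) FROM END-II.**  The conclusion of
`ShellMeasureWilsonGaugeInvariant.slotAntiConcentration_wilson_su2_gaugeInvariant` verbatim — non-wrapping box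
`[lo, hi]` (`hi − lo < sitesPerDir`, `hi ≤ lo + m`), chart bonds `Λ` = the box bonds off the axial comb with an
enumeration `e` of the `n = 3·#Λ` coordinates, window half-side `0 < S ≤ 1/8` (`3S² < π²`), co-test threshold `σ > 0`
with the reach condition `(d−1)·m·σ ≤ 2S/π`, classifier plaquettes `∅ ≠ P_u ⊆ boxPlaqs`, weight plaquettes `P_w`,
`β ≥ 0`, `θ > 0`, `0 ≤ δ < 1`, `0 ≤ ρ ≤ (1−δ)/2`; density `giF = 1[box plaquettes σ-small]·e^{−β·Wilson}`, classifier
`wilsonU`; CONCLUSION `SlotAntiConcentration ((fieldMeasure P j SU2).withDensity giF) wilsonU θ ρ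
(2(n + β Σ_{p∈P_w} 8S(8 + 32S))/(1−δ))` — obtained by INHABITING the level data of END-II
(`slotAC_realized_su2_of_levelData_cube`, §1) on the cell's own level-0 objects (see the module docstring): the only
inputs that are not identities are (SM) in END-II's currency `36(e^{8S·Rad} − 1)/(Rad − 1)² ≤ δθ` for a free radius
`Rad > 1` of the complexified contraction, and (SM)_σ `4(8S)²e^{16S} ≤ δσ` making the co-test centre-monotone.  So
END-II's binders SM-L1…L6 + dictionary are JOINTLY INHABITED at level 0.  (M1)₀ realized ≠ NE7c. [folklore] -/
theorem slotAntiConcentration_wilson_su2_gaugeInvariant_of_levelData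
    {lo hi : Fin P.d → ℤ} {m : ℕ} (hN : ∀ κ, hi κ - lo κ < P.sitesPerDir j) (hm : ∀ κ, hi κ ≤ lo κ + m)
    (Λ : Finset (PBond P j)) (hΛbox : ∀ b ∈ Λ, b ∈ boxBonds lo hi)
    (hΛcomb : Disjoint Λ (combBonds lo hi))
    (hcov : ∀ b ∈ boxBonds lo hi, b ∉ Λ → b ∈ (combBonds lo hi : Finset (PBond P j)))
    {n : ℕ} (e : ↥Λ × Fin 3 ≃ Fin n)
    {S σ : ℝ} (hS : 0 < S) (hS8 : S ≤ 1 / 8) (hSπ : 3 * S ^ 2 < Real.pi ^ 2) (hσ : 0 < σ)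
    (hrad : ((P.d - 1 : ℕ) : ℝ) * m * σ ≤ 2 * S / Real.pi)
    {Pu : Finset (Plaq P j)} (hPu : Pu.Nonempty) (hPubox : ∀ p ∈ Pu, p ∈ boxPlaqs lo hi)
    (Pw : Finset (Plaq P j)) {β θ δ ρ Rad : ℝ} (hβ : 0 ≤ β) (hθ : 0 < θ) (hδ0 : 0 ≤ δ) (hδ1 : δ < 1) (hρ0 : 0 ≤ ρ)
    (hρ : ρ ≤ (1 - δ) / 2) (hRad : 1 < Rad)
    (hSM : 36 * (Real.exp (8 * S * Rad) - 1) / (Rad - 1) ^ 2 ≤ δ * θ)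
    (hSMσ : 4 * (8 * S) ^ 2 * Real.exp (2 * (8 * S)) ≤ δ * σ) :
    SlotAntiConcentration ((fieldMeasure P j SU2).withDensity (giF lo hi σ β Pw)) (wilsonU hPu) θ ρ
      (2 * ((n : ℝ) + β * ∑ _p ∈ Pw, (8 * S) * (8 + 4 * (8 * S))) / (1 - δ)) := by
  classical
  have h8S1 : 8 * S ≤ 1 := by linarith
  -- the tree: the axial comb of the non-wrapping box is loop-free
  have hT := noClosedLoop_combBonds (P := P) (j := j) hN
  -- the tree-gauged exterior carries unit letters on the comb
  have hWcomb : ∀ (V : GaugeField P j SU2), ∀ b ∈ boxBonds lo hi, b ∉ Λ →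
      fixTo (combBonds lo hi) 1 V b = 1 :=
    fun V b hb hbΛ => fixTo_comb_eq_one lo hi V b (hcov b hb hbΛ)
  -- generator lists of the box plaquette words (comb letters drop out)
  have hgen : ∀ (V : GaugeField P j SU2) (x : Fin n → ℝ) (p : Plaq P j), p ∈ boxPlaqs lo hi →
      ∃ l : List M₂, normSum l = sGen (plaqWord Λ e (fixTo (combBonds lo hi) 1 V) x p) ∧
        ∀ c : ℝ, wordEval c (plaqWord Λ e (fixTo (combBonds lo hi) 1 V) x p) = wordExp (scale c l) :=
    fun V x p hp => exists_gens_of_frozen_eq_one _ (frozen_eq_one_of_mem_plaqWord Λ e (hWcomb V) x hp)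
  choose! L hLnorm hLeval using hgen
  -- the section of the tree-gauged configuration is the tree-gauged section
  have hsec : ∀ (V : GaugeField P j SU2) (y : ↥Λ → SU2),
      fixTo (combBonds lo hi) 1 (updateFinset V Λ y) = updateFinset (fixTo (combBonds lo hi) 1 V) Λ y :=
    fun V y => fixTo_updateFinset_of_disjoint hΛcomb 1 V y
  -- DICTIONARY for box plaquettes: the plaquette variable at the chart point `c • x` is the scaled word
  have hD1 : ∀ (V : GaugeField P j SU2) (x : Fin n → ℝ) (p : Plaq P j), p ∈ boxPlaqs lo hi → ∀ c : ℝ,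
      dist1 (GaugeField.plaqHol (fixTo (combBonds lo hi) 1
        (updateFinset V Λ (expFibreChart Λ 1 e (c • x)))) p) = ‖wordExp (scale c (L V x p)) - 1‖ := by
    intro V x p hp c
    rw [hsec, ← (wilson_dictionary_specialUnitaryGroup _).2, coe_plaqHol_eq_wordEval, wordEval_plaqWord_smul,
      hLeval V x p hp c]
  have hD1one : ∀ (V : GaugeField P j SU2) (x : Fin n → ℝ) (p : Plaq P j), p ∈ boxPlaqs lo hi →
      dist1 (GaugeField.plaqHol (fixTo (combBonds lo hi) 1
        (updateFinset V Λ (expFibreChart Λ 1 e x))) p) = ‖wordExp (L V x p) - 1‖ := by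
    intro V x p hp
    have h := hD1 V x p hp 1
    rwa [one_smul, ShellMeasureWilsonWords.scale_one] at h
  -- sizes on the cube: `normSum (L V x p) ≤ 8S`
  have hLsize : ∀ (V : GaugeField P j SU2) (x : Fin n → ℝ), x ∈ cube n S → ∀ p ∈ boxPlaqs lo hi,
      normSum (L V x p) ≤ 8 * S := by
    intro V x hx p hp
    rw [hLnorm V x p hp]
    exact (plaqWord_data Λ e hS.le (fixTo (combBonds lo hi) 1 V) hx p).2.1
  -- the co-test is CENTRE-MONOTONE on the cube (level-0 core map at threshold σ, every contraction `0 < c ≤ 1`)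
  have hmono : ∀ (V : GaugeField P j SU2) (x : Fin n → ℝ), x ∈ cube n S → ∀ c : ℝ, 0 < c → c ≤ 1 →
      fixTo (combBonds lo hi) 1 (updateFinset V Λ (expFibreChart Λ 1 e x)) ∈ boxTest lo hi σ →
      fixTo (combBonds lo hi) 1 (updateFinset V Λ (expFibreChart Λ 1 e (c • x))) ∈ boxTest lo hi σ := by
    intro V x hx c hc0 hc1 hmem p hp
    rw [hD1 V x p hp c]
    have h1 : ‖wordExp (L V x p) - 1‖ < σ := by rw [← hD1one V x p hp]; exact hmem p hp
    have hs := hLsize V x hx p hp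
    have hδc : δ * c ≤ 1 := by nlinarith
    have hcρ : c * (1 + δ * (1 - c)) ≤ 1 - 0 := by nlinarith [mul_nonneg (mul_nonneg hδ0 hc0.le) (sub_nonneg.2 hc1)]
    have h := coreMap_word (L V x p) hc0 hc1 (hs.trans h8S1) hσ
      ((interpConst_mono (normSum_nonneg _) hs).trans hSMσ) hcρ h1
    simpa using h
  -- END-II with the level-0 level data
  have h := slotAC_realized_su2_of_levelData_cube (A := M₂) hT 1 Λ e hS hSπ (fun _ => (1 : GaugeField P j SU2))
    (R := fun V y => giF lo hi σ β Pw (fixTo (combBonds lo hi) 1 (updateFinset V Λ y)))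
    (fun V => (measurable_giF lo hi σ β Pw).comp ((measurable_fixTo _ 1).comp measurable_updateFinset))
    (measurable_giF lo hi σ β Pw) (gaugeInvariant_giF lo hi σ β Pw) ?hFw
    (fun V => withDensity_univ_ne_top_of_le_one (blockLaw Λ) fun y => giF_le_one lo hi hβ Pw _)
    (measurable_wilsonU hPu) (gaugeInvariant_wilsonU hPu)
    (matrixTrace (n := Fin 2)) matrixTrace_N_pos hPu
    (fun V p x => wordEval 1 (plaqWord Λ e (fixTo (combBonds lo hi) 1 V) x p))
    (fun V p _ => continuous_wordEval_plaqWord Λ e _ p 1) Pw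
    (fun V p x => wordEval 1 (plaqWord Λ e (fixTo (combBonds lo hi) 1 V) x p)) (fun _ _ => (0 : ℝ))
    (fun _ => cube n S)
    (fun V x => (cube n S).indicator 1 x *
      (boxTest lo hi σ).indicator 1 (fixTo (combBonds lo hi) 1 (updateFinset V Λ (expFibreChart Λ 1 e x))))
    (θ := θ) (δ := δ) (ρ := ρ) (β := β) (Rad := Rad) (H := Real.exp (8 * S * Rad) - 1) (B𝓔 := 0)
    (sw := fun _ => 8 * S) (lw := fun _ => 8 * S) (dw := fun _ => 8)
    ?hRdict ?hudict ?hJW ?hJ hRad ?hAN ?hGW (fun _ _ => h8S1) (fun _ _ => by positivity) (fun _ _ => by positivity)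
    (fun _ _ => by norm_num) ?hE le_rfl hθ hδ0 hδ1 hρ0 hρ hβ ?hSM
  · simpa only [add_zero] using h
  case hFw =>
    -- (LR)₀: the window factorisation is IMPLIED (exactly as in `ShellMeasureWilsonGaugeInvariant`)
    intro V y
    by_cases hmem : fixTo (combBonds lo hi) 1 (updateFinset V Λ y) ∈ boxTest lo hi σ
    · have hwin : expWindowDensity Λ 1 S (fixTo (combBonds lo hi) 1 (updateFinset V Λ y)) = 1 :=
        expWindowDensity_eq_one_of_comb _ (S₀ := boxPlaqs lo hi) subset_rfl hmem hσ.le hm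
          (fixTo_comb_eq_one lo hi _) hS.le hrad hΛbox
      have hcongr : expWindowDensity Λ 1 S (fixTo (combBonds lo hi) 1 (updateFinset V Λ y)) =
          expWindowDensity Λ (1 : GaugeField P j SU2) S (updateFinset (1 : GaugeField P j SU2) Λ y) :=
        expWindowDensity_congr fun b hb => by
          have hbT : b ∉ combBonds lo hi := Finset.disjoint_left.1 hΛcomb hb
          simp [fixTo, updateFinset, hb, hbT]
      rw [← hcongr, hwin, ENNReal.ofReal_one, one_mul]
    · have h0 : giF lo hi σ β Pw (fixTo (combBonds lo hi) 1 (updateFinset V Λ y)) = 0 := by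
        unfold giF; rw [indicator_of_notMem hmem, zero_mul]
      rw [h0, mul_zero]
  case hRdict =>
    -- the block weight on the chart cube IS co-test × Wilson weight of the sectioned words
    intro V x hx
    simp only [indicator_of_mem hx, Pi.one_apply, one_mul]
    unfold giF weight action
    have hsum := wilsonSum_chart_smul Λ e Pw (fixTo (combBonds lo hi) 1 V) x 1
    rw [one_smul] at hsum
    rw [add_zero, hsec, hsum, ← hsec]
  case hudict =>
    -- the classifier of the tree-gauged section IS `max_p ‖word_p − 1‖` (an identity at EVERY chart point)
    intro V x _
    unfold wilsonU classifier
    refine Finset.sup'_congr hPu rfl fun p _ => ?_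
    rw [hsec, ← (wilson_dictionary_specialUnitaryGroup _).2, coe_plaqHol_eq_wordEval]
  case hJW =>
    intro V x hJx
    by_contra hx
    exact hJx (by rw [indicator_of_notMem hx, zero_mul])
  case hJ =>
    intro V x a ha
    have hc0 : 0 < Real.exp (-a) := Real.exp_pos _
    have hc1 : Real.exp (-a) ≤ 1 := by rw [Real.exp_le_one_iff]; linarith
    by_cases hx : x ∈ cube n S
    · by_cases hmem : fixTo (combBonds lo hi) 1 (updateFinset V Λ (expFibreChart Λ 1 e x)) ∈ boxTest lo hi σ
      · have hx' : Real.exp (-a) • x ∈ cube n S := smul_mem_cube hx hc0.le hc1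
        have hmem' := hmono V x hx (Real.exp (-a)) hc0 hc1 hmem
        rw [indicator_of_mem hx, indicator_of_mem hx', indicator_of_mem hmem, indicator_of_mem hmem']
        simp only [Pi.one_apply, mul_one, le_refl]
      · rw [indicator_of_notMem hmem, mul_zero]
        exact bot_le
    · rw [indicator_of_notMem hx, zero_mul]
      exact bot_le
  case hAN =>
    -- (AN-bound)₀: the plaquette functional of the LINEAR bond rays, `H = e^{8S·Rad} − 1`
    intro V x hx p hp
    obtain ⟨f, hf, hb, h0, hc⟩ := classifierWitness_linear (L V x p) Rad
    refine ⟨f, hf, fun w hw => (hb w hw).trans ?_, h0, fun c' h1 h2 => ?_⟩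
    · have hs := hLsize V x hx p (hPubox p hp)
      have hR0 : 0 ≤ Rad := by linarith
      apply sub_le_sub_right
      apply Real.exp_le_exp.2
      nlinarith
    · rw [hc c' h1 h2]
      show wordExp (scale c' (L V x p)) - 1 = wordEval 1 (plaqWord Λ e (fixTo (combBonds lo hi) 1 V) (c' • x) p) - 1
      rw [wordEval_plaqWord_smul, hLeval V x p (hPubox p hp) c']
  case hGW =>
    -- graded sectioned words moving LINEARLY: `s̄ = L̄ = 8S`, `d̄ = 8`
    intro V x hx p _
    obtain ⟨hgood, hs, hd⟩ := plaqWord_data Λ e hS.le (fixTo (combBonds lo hi) 1 V) hx p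
    obtain ⟨gw, hg, hss, hls, hmd, hev⟩ := exists_graded_of_word (matrixTrace (n := Fin 2)) _ hgood
    refine ⟨gw, hg, hss ▸ hs, hls ▸ hs, hmd ▸ hd, fun c' _ _ => ?_⟩
    show mwordEval c' (gw.map Prod.fst) = wordEval 1 (plaqWord Λ e (fixTo (combBonds lo hi) 1 V) (c' • x) p)
    rw [hev c', wordEval_plaqWord_smul]
  case hE =>
    intro V x _ c' _ _
    simp
  case hSM =>
    simpa only [one_pow, mul_one] using hSM

end Main

end Summit.QuantumFields.BalabanUV.T4Continuum.ShellMeasureRootCompositionLevelZero
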